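import Literature.Computability.Complexity.PrivateCoinGamesTools
import HarnessLib

/-!
# Private-coin games: API for round-by-round analyses of the value `opt`

Companion of `PrivateCoinGames.lean` / `PrivateCoinGamesTools.lean` (`PCGame R M`, the
backward-induction value `PCGame.opt` and its unfolding lemmas): the prover's-turn lemmas
`le_opt_succ_of_not_even`, `opt_succ_eq_opt_bestReply`, the fibre decomposition of the
consistent coins over the verifier's next message (`sum_card_filter_consistent_append`), the crude
range `opt ≤ #consistent ≤ |R|` (`opt_le_card_consistent`, `opt_le_card`), and the plays in which
the prover is not consulted (`card_accept_play_eq_opt_of_le_one`). This is the interface through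
which the Goldwasser–Sipser simulation (`GoldwasserSipserGame.lean`, toward the named fact
`Literature.Computability.Complexity.GoldwasserSipser1986_IPk_subset_AMk`) bounds `opt` round by
round: `Σ_a max_{a'} opt (h a a') = opt h` at a hashing round, `#accepting consistent coins = opt`
at the end. Mathlib only, all proved, [folklore] throughout.

## References

* S. Arora, B. Barak, *Computational Complexity: A Modern Approach*, CUP 2009, §8.1, §8.2.3.
* L. Babai, S. Moran, *Arthur–Merlin games …*, JCSS 36 (1988), §2.3 (game-tree evaluation).
-/

namespace Literature.Computability.Complexity

open Finset

namespace PCGame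

variable {R M : Type*} (G : PCGame R M) [Fintype R] [Fintype M]

open scoped Classical in
/-- On the prover's turn every reply is worth at most the node. [folklore] -/
theorem le_opt_succ_of_not_even {h : List M} (ho : ¬ Even h.length) (n : ℕ) (b : M) :
    G.opt n (h ++ [b]) ≤ G.opt (n + 1) h := by
  rw [G.opt_succ_of_not_even ho]
  exact le_sup (f := fun b : M => G.opt n (h ++ [b])) (mem_univ b)

open scoped Classical in
/-- On the prover's turn the node is worth exactly its best reply. [folklore] -/
theorem opt_succ_eq_opt_bestReply [Nonempty M] {h : List M} (ho : ¬ Even h.length) (n : ℕ) :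
    G.opt (n + 1) h = G.opt n (h ++ [G.bestReply n h]) :=
  le_antisymm (by rw [G.opt_succ_of_not_even ho]; exact Finset.sup_le fun b _ => G.opt_le_opt_bestReply n h b)
    (G.le_opt_succ_of_not_even ho n _)

open scoped Classical in
/-- **The fibres over the verifier's next message partition the consistent coins**: on the
verifier's turn, summing over its possible messages `a` the number of coins consistent with
`h ++ [a]` that satisfy a property `Q` there gives the number of coins consistent with `h` that
satisfy `Q` after the verifier's own message. [folklore] -/
theorem sum_card_filter_consistent_append {h : List M} (he : Even h.length) (Q : R → List M → Prop) :
    ∑ a : M, (univ.filter fun r => G.Consistent r (h ++ [a]) ∧ Q r (h ++ [a])).card =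
      (univ.filter fun r => G.Consistent r h ∧ Q r (h ++ [G.next r h])).card := by
  symm
  rw [card_eq_sum_card_fiberwise (f := fun r => G.next r h) (t := univ) fun _ _ => mem_univ _]
  refine sum_congr rfl fun a _ => ?_
  rw [filter_filter]
  refine congrArg card (filter_congr fun r _ => ?_)
  rw [G.consistent_append_iff_of_even r he]
  constructor
  · rintro ⟨⟨hc, hq⟩, rfl⟩
    exact ⟨⟨hc, rfl⟩, hq⟩
  · rintro ⟨⟨hc, rfl⟩, hq⟩
    exact ⟨⟨hc, hq⟩, rfl⟩

open scoped Classical in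
/-- **The value is bounded by the number of consistent coins.** [folklore] -/
theorem opt_le_card_consistent :
    ∀ (n : ℕ) (h : List M), G.opt n h ≤ (univ.filter fun r => G.Consistent r h).card
  | 0, h => by
    rw [opt_zero]
    exact card_le_card (monotone_filter_right _ fun r _ hr => hr.1)
  | n + 1, h => by
    by_cases he : Even h.length
    · rw [G.opt_succ_of_even he]
      have hf := G.sum_card_filter_consistent_append he fun _ _ => True
      simp only [and_true] at hf
      rw [← hf]
      exact sum_le_sum fun a _ => opt_le_card_consistent n _
    · rw [G.opt_succ_of_not_even he]
      refine Finset.sup_le fun b _ => (opt_le_card_consistent n _).trans (card_le_card ?_)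
      exact monotone_filter_right _ fun r _ hr => (G.consistent_append_iff_of_not_even r he b).1 hr

open scoped Classical in
/-- Hence `opt n h ≤ |R|`. [folklore] -/
theorem opt_le_card (n : ℕ) (h : List M) : G.opt n h ≤ Fintype.card R :=
  (G.opt_le_card_consistent n h).trans (card_filter_le _ _ |>.trans (card_univ (α := R)).le)

open scoped Classical in
/-- **No prover is consulted in the last verifier message**: from a history of even length with at
most one message to go, every strategy brings exactly `opt` consistent coins to acceptance.
[folklore] -/
theorem card_accept_play_eq_opt_of_le_one (σ : List M → M) {n : ℕ} (hn : n ≤ 1) {h : List M}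
    (he : Even h.length) :
    (univ.filter fun r => G.Consistent r h ∧ G.accept r (G.play r σ n h)).card = G.opt n h := by
  rcases Nat.le_one_iff_eq_zero_or_eq_one.1 hn with rfl | rfl
  · simp [opt]
  · rw [G.opt_succ_of_even he]
    simp only [play_succ, play_zero, he, if_true, opt_zero]
    exact (G.sum_card_filter_consistent_append he fun r h' => G.accept r h').symm

end PCGame

end Literature.Computability.Complexity
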